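import Literature.Probability.RandomPlanarGeometry.ChordalBoundary
import Literature.Probability.RandomPlanarGeometry.ConformalMapCaratheodoryProofs
import Literature.Probability.RandomPlanarGeometry.SLE
import HarnessLib

/-!
# SLE₆ side-arc touch law, part 2: boundary correspondence of a chordal map on a period window

Helper file for the registered stub `stub_sleSideTouch` (statement `SleSideTouch`) of the line
`collar-touch-sandwich` of crux `SLESixFamiliesGiveCardy` (stmt-CriticalPhenomena-9654).

Let `D` be a Jordan domain, `ψ : ℍₒ → D` a conformal equivalence with boundary value
`D.boundary τ` at `∞`, and `Φ` a Carathéodory disc extension of `ψ ∘ C⁻¹`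
(`JordanDomain.IsDiscExtension`, from `JordanDomain.exists_continuousOn_extension_holds`). On the
period window `W = (τ - 1, τ)` the pulled-back parametrisation `g = JordanDomain.discParam D Φ`
(`Ψ (g t) = boundary t`, `Ψ = ψ.boundaryExtension`) is continuous, injective, hence strictly
monotone or antitone, and every real point is `g t` for some `t ∈ W`. Consequently a closed
sub-arc `boundary '' [α, β]`, `τ - 1 < α ≤ β < τ`, pulls back under `Ψ` (on the closed
half-plane) to the compact real segment `uIcc (g α) (g β)`
(`boundaryExtension_mem_image_Icc_iff`), and if `ψ` has boundary value `boundary t₀` at `0`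
(`t₀ ∈ W` off `[α, β]`) the two end points `g α, g β` are non-zero reals of the same sign
(`discParam_mul_pos`). This is the generalisation to an arbitrary target parameter `τ` of the
chord-`(a, c)` bookkeeping of `Literature/…/ChordalBoundary.lean` (which treats `τ = mark c`),
used for the Dobrushin domains `Q.chord 0 1` (`τ = mark 1`) and `Q.chord 0 3` (`τ = mark 3`).

Also: the deterministic reading of the range event of a time-compactified image
(`mk_mem_hitsBefore_empty_iff`).
-/

noncomputable section

open Set Filter Topology Complex Metric
open UpperHalfPlane (upperHalfPlaneSet)
open scoped NNReal unitInterval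

namespace Summit.CriticalPhenomena.CardyFormulaZ2.Cruxes.SLESixFamiliesGiveCardy.CollarTouchSandwich

open Literature.Probability.RandomPlanarGeometry

variable {D : JordanDomain} {ψ : ConformalEquiv upperHalfPlaneSet D.carrier} {Φ : ℂ → ℂ} {τ : ℝ}

section Window

variable (h : JordanDomain.IsDiscExtension D ψ Φ) (hτ : ψ.HasBoundaryValueAtInfty (D.boundary τ))
include h hτ

/-- Inside the period window `(τ - 1, τ)` no parameter is mapped to `Φ 1 = boundary τ`. -/
theorem boundary_ne_apply_one_of_mem_window {t : ℝ} (ht : t ∈ Ioo (τ - 1) τ) :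
    D.boundary t ≠ Φ 1 := by
  rw [h.apply_one_eq hτ, ← D.periodic_boundary.sub_eq τ]
  intro heq
  have := D.injOn_boundary_Ico (τ - 1) ⟨ht.1.le, by linarith [ht.2]⟩ ⟨le_rfl, by linarith⟩ heq
  exact ht.1.ne' this

/-- The pulled-back parametrisation is continuous on the period window. -/
theorem continuousOn_discParam_window :
    ContinuousOn (JordanDomain.discParam D Φ) (Ioo (τ - 1) τ) :=
  h.continuousOn_discParam.mono fun _ ht ↦ boundary_ne_apply_one_of_mem_window h hτ ht

/-- The pulled-back parametrisation is injective on the period window. -/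
theorem injOn_discParam_window : InjOn (JordanDomain.discParam D Φ) (Ioo (τ - 1) τ) := by
  intro t ht s hs hts
  have key : D.boundary t = D.boundary s := by
    rw [← h.boundaryExtension_discParam (boundary_ne_apply_one_of_mem_window h hτ ht),
      ← h.boundaryExtension_discParam (boundary_ne_apply_one_of_mem_window h hτ hs)]
    exact congrArg _ (congrArg _ hts)
  exact D.injOn_boundary_Ico (τ - 1) ⟨ht.1.le, by linarith [ht.2]⟩ ⟨hs.1.le, by linarith [hs.2]⟩ key

/-- **The pulled-back parametrisation is strictly monotone or strictly antitone on the period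
window** (continuous and injective on an interval). -/
theorem strictMonoOn_or_strictAntiOn_discParam_window :
    StrictMonoOn (JordanDomain.discParam D Φ) (Ioo (τ - 1) τ) ∨
      StrictAntiOn (JordanDomain.discParam D Φ) (Ioo (τ - 1) τ) :=
  (continuousOn_discParam_window h hτ).strictMonoOn_of_injOn_Ioo (by linarith)
    (injOn_discParam_window h hτ)

/-- Every real `x` is `discParam t` for some `t` in the period window, with `boundary t = Ψ x`. -/
theorem exists_mem_window_discParam_eq (x : ℝ) : ∃ t ∈ Ioo (τ - 1) τ,
    D.boundary t = ψ.boundaryExtension x ∧ JordanDomain.discParam D Φ t = x := by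
  obtain ⟨t, ht, hbt, hpt⟩ := h.exists_mem_Ico_discParam_eq x (τ - 1)
  refine ⟨t, ⟨ht.1.lt_of_ne ?_, by linarith [ht.2]⟩, hbt, hpt⟩
  rintro rfl
  refine h.boundaryExtension_ofReal_ne x ?_
  rw [← hbt, h.apply_one_eq hτ, D.periodic_boundary.sub_eq]

/-- `ψ` has boundary value `boundary t` at `discParam t`, for `t` in the period window. -/
theorem hasBoundaryValue_discParam_window {t : ℝ} (ht : t ∈ Ioo (τ - 1) τ) :
    ψ.HasBoundaryValue (JordanDomain.discParam D Φ t) (D.boundary t) := by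
  have h1 := h.tendsto_nhdsWithin (z := (JordanDomain.discParam D Φ t : ℂ)) (by simp)
  rwa [h.boundaryExtension_discParam (boundary_ne_apply_one_of_mem_window h hτ ht)] at h1

omit h hτ in
/-- Inside the period window, `boundary t ∈ boundary '' [α, β]` iff `t ∈ [α, β]`
(`τ - 1 < α`, `β < τ`). -/
theorem boundary_mem_image_Icc_iff {α β t : ℝ} (hα : τ - 1 < α) (hβ : β < τ)
    (ht : t ∈ Ioo (τ - 1) τ) : D.boundary t ∈ D.boundary '' Icc α β ↔ t ∈ Icc α β := by
  refine ⟨?_, fun hmem ↦ ⟨t, hmem, rfl⟩⟩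
  rintro ⟨t', ht', heq⟩
  have := D.injOn_boundary_Ico (τ - 1) ⟨by linarith [ht'.1], by linarith [ht'.2]⟩
    ⟨ht.1.le, by linarith [ht.2]⟩ heq
  rw [← this]
  exact ht'

/-- The image of `[α, β] ⊆ (τ - 1, τ)` under the pulled-back parametrisation is the compact
segment between `discParam α` and `discParam β`. -/
theorem image_discParam_Icc {α β : ℝ} (hα : τ - 1 < α) (hαβ : α ≤ β) (hβ : β < τ) :
    JordanDomain.discParam D Φ '' Icc α β =
      uIcc (JordanDomain.discParam D Φ α) (JordanDomain.discParam D Φ β) := by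
  have hsub : uIcc α β ⊆ Ioo (τ - 1) τ := by
    rw [uIcc_of_le hαβ]; exact fun t ht ↦ ⟨hα.trans_le ht.1, ht.2.trans_lt hβ⟩
  rw [← uIcc_of_le hαβ]
  refine Subset.antisymm ?_ (intermediate_value_uIcc ((continuousOn_discParam_window h hτ).mono hsub))
  rcases strictMonoOn_or_strictAntiOn_discParam_window h hτ with hg | hg
  · exact ((hg.mono hsub).monotoneOn).image_uIcc_subset
  · exact ((hg.mono hsub).antitoneOn).image_uIcc_subset

/-- **A closed sub-arc pulls back to a compact real segment.** For `im z ≥ 0` and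
`τ - 1 < α ≤ β < τ`: `Ψ z ∈ boundary '' [α, β]` iff `z` is real with
`re z ∈ uIcc (discParam α) (discParam β)`. -/
theorem boundaryExtension_mem_image_Icc_iff {α β : ℝ} (hα : τ - 1 < α) (hαβ : α ≤ β) (hβ : β < τ)
    {z : ℂ} (hz : 0 ≤ z.im) :
    ψ.boundaryExtension z ∈ D.boundary '' Icc α β ↔
      z.im = 0 ∧ z.re ∈ uIcc (JordanDomain.discParam D Φ α) (JordanDomain.discParam D Φ β) := by
  have hzre : z.im = 0 → z = ((z.re : ℝ) : ℂ) := fun him ↦ Complex.ext (by simp) (by simp [him])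
  obtain ⟨t, ht, hbt, hgt⟩ := exists_mem_window_discParam_eq h hτ z.re
  rw [← image_discParam_Icc h hτ hα hαβ hβ]
  constructor
  · intro hmem
    have him : z.im = 0 := JordanDomain.im_eq_zero_of_boundaryExtension_mem_frontier ψ hz
      (by obtain ⟨s, -, hs⟩ := hmem; rw [← hs]; exact D.boundary_mem_frontier s)
    refine ⟨him, ?_⟩
    rw [hzre him, ← hbt, boundary_mem_image_Icc_iff hα hβ ht] at hmem
    exact ⟨t, hmem, hgt⟩
  · rintro ⟨him, t', ht', hgt'⟩
    have ht'W : t' ∈ Ioo (τ - 1) τ := ⟨hα.trans_le ht'.1, ht'.2.trans_lt hβ⟩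
    have htt' : t' = t := injOn_discParam_window h hτ ht'W ht (hgt'.trans hgt.symm)
    rw [hzre him, ← hbt, boundary_mem_image_Icc_iff hα hβ ht, ← htt']
    exact ht'

omit hτ in
/-- The pulled-back parametrisation vanishes at the parameter `t₀` of the boundary value at `0`. -/
theorem discParam_eq_zero_of_hasBoundaryValue {t₀ : ℝ} (h₀ : ψ.HasBoundaryValue 0 (D.boundary t₀)) :
    JordanDomain.discParam D Φ t₀ = 0 := by
  refine h.discParam_eq ?_
  rw [ofReal_zero, JordanDomain.boundaryExtension_eq_of_hasBoundaryValue' ψ (by simp) h₀]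

/-- **Order of the end points, segment before `t₀`.** If `ψ` has boundary value `boundary t₀` at
`0` (`t₀` in the window) and `τ - 1 < α < β < t₀`, then `discParam α < discParam β < 0`
(parametrisation increasing) or `0 < discParam β < discParam α` (decreasing). -/
theorem discParam_order_of_lt_left {t₀ α β : ℝ} (ht₀ : t₀ ∈ Ioo (τ - 1) τ)
    (h₀ : ψ.HasBoundaryValue 0 (D.boundary t₀)) (hα : τ - 1 < α) (hαβ : α < β) (hβ : β < t₀) :
    JordanDomain.discParam D Φ α < JordanDomain.discParam D Φ β ∧ JordanDomain.discParam D Φ β < 0 ∨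
      0 < JordanDomain.discParam D Φ β ∧ JordanDomain.discParam D Φ β < JordanDomain.discParam D Φ α := by
  have hg0 := discParam_eq_zero_of_hasBoundaryValue h h₀
  have hαW : α ∈ Ioo (τ - 1) τ := ⟨hα, hαβ.trans (hβ.trans ht₀.2)⟩
  have hβW : β ∈ Ioo (τ - 1) τ := ⟨hα.trans hαβ, hβ.trans ht₀.2⟩
  rcases strictMonoOn_or_strictAntiOn_discParam_window h hτ with hg | hg
  · exact Or.inl ⟨hg hαW hβW hαβ, hg0 ▸ hg hβW ht₀ hβ⟩
  · exact Or.inr ⟨hg0 ▸ hg hβW ht₀ hβ, hg hαW hβW hαβ⟩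

/-- **Order of the end points, segment after `t₀`.** If `ψ` has boundary value `boundary t₀` at
`0` (`t₀` in the window) and `t₀ < α < β < τ`, then `0 < discParam α < discParam β`
(parametrisation increasing) or `discParam β < discParam α < 0` (decreasing). -/
theorem discParam_order_of_lt_right {t₀ α β : ℝ} (ht₀ : t₀ ∈ Ioo (τ - 1) τ)
    (h₀ : ψ.HasBoundaryValue 0 (D.boundary t₀)) (hα : t₀ < α) (hαβ : α < β) (hβ : β < τ) :
    0 < JordanDomain.discParam D Φ α ∧ JordanDomain.discParam D Φ α < JordanDomain.discParam D Φ β ∨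
      JordanDomain.discParam D Φ β < JordanDomain.discParam D Φ α ∧ JordanDomain.discParam D Φ α < 0 := by
  have hg0 := discParam_eq_zero_of_hasBoundaryValue h h₀
  have hαW : α ∈ Ioo (τ - 1) τ := ⟨ht₀.1.trans hα, hαβ.trans hβ⟩
  have hβW : β ∈ Ioo (τ - 1) τ := ⟨ht₀.1.trans (hα.trans hαβ), hβ⟩
  rcases strictMonoOn_or_strictAntiOn_discParam_window h hτ with hg | hg
  · exact Or.inl ⟨hg0 ▸ hg ht₀ hαW hα, hg hαW hβW hαβ⟩
  · exact Or.inr ⟨hg hαW hβW hαβ, hg0 ▸ hg ht₀ hαW hα⟩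

end Window

/-- **A closed sub-arc pulls back to a compact real segment** (registered helper of
`stub_sleSideTouch`; arrow-style export of `boundaryExtension_mem_image_Icc_iff`). For a Jordan
domain `D`, a conformal map `ψ : ℍₒ → D` with boundary value `boundary τ` at `∞` and a Carathéodory
disc extension `Φ`, a parameter segment `[α, β] ⊆ (τ - 1, τ)` and `im z ≥ 0`:
`Ψ z ∈ boundary '' [α, β]` iff `z` is real with `re z ∈ uIcc (discParam α) (discParam β)`. -/
theorem arc_pullback_segment :
    ∀ {D : JordanDomain} {ψ : ConformalEquiv upperHalfPlaneSet D.carrier} {Φ : ℂ → ℂ} {τ : ℝ}, JordanDomain.IsDiscExtension D ψ Φ → ψ.HasBoundaryValueAtInfty (D.boundary τ) → ∀ {α β : ℝ}, τ - 1 < α → α ≤ β → β < τ → ∀ {z : ℂ}, 0 ≤ z.im → (ψ.boundaryExtension z ∈ D.boundary '' Icc α β ↔ z.im = 0 ∧ z.re ∈ uIcc (JordanDomain.discParam D Φ α) (JordanDomain.discParam D Φ β)) :=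
  fun h hτ _ _ hα hαβ hβ _ hz ↦ boundaryExtension_mem_image_Icc_iff h hτ hα hαβ hβ hz

/-! ### The range event of a time-compactified image -/

/-- **Deterministic reading of the range event.** Let `c` be the time-compactified image of the
path `γ` under `Ψ` with end point `b ∉ A`, and suppose `Ψ (γ t) ∈ A` iff `γ t` is a real point of
`J ⊆ ℝ`. Then the class of `c` meets `A` (event `hitsBefore A ∅`) iff some point of `J` is on `γ`. -/
theorem mk_mem_hitsBefore_empty_iff {Ψ : ℂ → ℂ} {γ : ℝ≥0 → ℂ} {b : ℂ} {c : Curve ℂ} {A : Set ℂ}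
    {J : Set ℝ} (hΨA : ∀ t, Ψ (γ t) ∈ A ↔ (γ t).im = 0 ∧ (γ t).re ∈ J) (hb : b ∉ A)
    (hc : IsCompactifiedImage Ψ γ b c) :
    CurveClass.mk c ∈ CurveClass.hitsBefore A (∅ : Set ℂ) ↔ ∃ r : ℝ, r ∈ J ∧ (r : ℂ) ∈ range γ := by
  rw [CurveClass.hitsBefore_empty_right, mem_compl_iff, CurveClass.mk_mem_rangeSubset]
  simp only [mem_compl_iff, not_forall, not_not]
  constructor
  · rintro ⟨s, hs⟩
    have hs1 : (s : ℝ) < 1 := by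
      refine lt_of_le_of_ne s.2.2 fun h1 ↦ hb ?_
      have : s = 1 := Subtype.ext h1
      rwa [this, hc.2] at hs
    rw [hc.1 s hs1, hΨA] at hs
    refine ⟨(γ (rayParam s)).re, hs.2, rayParam s, ?_⟩
    exact Complex.ext (by simp) (by simp [hs.1])
  · rintro ⟨r, hr, t, ht⟩
    obtain ⟨s, hs1, hst⟩ := exists_rayParam_eq t
    refine ⟨s, ?_⟩
    rw [hc.1 s hs1, hΨA, hst, ht]
    exact ⟨by simp, by simpa using hr⟩

/-! ### Uniformizing data built from a chordal map, and their cross-ratios -/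

section Datum

variable {R : ConformalRectangle} (ψ : ConformalEquiv upperHalfPlaneSet R.carrier)

/-- Cardy's cross-ratio of `(0, 1, s, 2)` is `(2 - s)/s`. -/
theorem crossRatio_zero_one_two' {s : ℝ} (hs : s ≠ 0) : crossRatio ![0, 1, s, 2] = (2 - s) / s := by
  simp only [crossRatio, Matrix.cons_val_zero, Matrix.cons_val_one, Matrix.cons_val]
  rw [div_eq_div_iff (mul_ne_zero (by rwa [zero_sub, neg_ne_zero]) (by norm_num)) hs]
  ring

/-- Cardy's cross-ratio of `(0, s, 1/2, 1)` is `s/(1 - s)`. -/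
theorem crossRatio_zero_half_one {s : ℝ} (hs : s ≠ 1) : crossRatio ![0, s, 1 / 2, 1] = s / (1 - s) := by
  have h1 : (1 : ℝ) - s ≠ 0 := sub_ne_zero.2 (Ne.symm hs)
  simp only [crossRatio, Matrix.cons_val_zero, Matrix.cons_val_one, Matrix.cons_val]
  rw [div_eq_div_iff (mul_ne_zero (by norm_num) (sub_ne_zero.2 hs)) h1]
  ring

/-- **Reading (U): a uniformizing datum from the chordal map of `(Ω; p₀, p₁)`.** If `ψ : ℍₒ → Ω`
has boundary values `p₀` at `0`, `p₁` at `∞`, `p₂` at `u₂` and `p₃` at `u₃`, where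
`u₂ < u₃ < 0` or `0 < u₃ < u₂`, then `R` has a uniformizing datum of cross-ratio `(u₂ - u₃)/u₂`
(precompose `ψ` with the real Möbius map `z ↦ (u₃/2) z/(z ∓ 1)` and take
`x = ±(0, 1, 2u₂/(2u₂ - u₃), 2)`). -/
theorem exists_isUniformizing_crossRatio_eq_U {u₂ u₃ : ℝ} (h₀ : ψ.HasBoundaryValue 0 (R.pt 0))
    (h₁ : ψ.HasBoundaryValueAtInfty (R.pt 1)) (h₂ : ψ.HasBoundaryValue u₂ (R.pt 2))
    (h₃ : ψ.HasBoundaryValue u₃ (R.pt 3)) (hsign : u₂ < u₃ ∧ u₃ < 0 ∨ 0 < u₃ ∧ u₃ < u₂) :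
    ∃ (φ₀ : ConformalEquiv upperHalfPlaneSet R.carrier) (x : Fin 4 → ℝ), R.IsUniformizing φ₀ x ∧
      crossRatio x = (u₂ - u₃) / u₂ := by
  set s : ℝ := 2 * u₂ / (2 * u₂ - u₃) with hs
  have hden : 2 * u₂ - u₃ ≠ 0 := by rcases hsign with ⟨h, h'⟩ | ⟨h, h'⟩ <;> intro hh <;> linarith
  have hs1 : 1 < s := by
    rcases hsign with ⟨h, h'⟩ | ⟨h, h'⟩
    · rw [hs, one_lt_div_of_neg (by linarith)]; linarith
    · rw [hs, one_lt_div (by linarith)]; linarith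
  have hs2 : s < 2 := by
    rcases hsign with ⟨h, h'⟩ | ⟨h, h'⟩
    · rw [hs, div_lt_iff_of_neg (by linarith)]; linarith
    · rw [hs, div_lt_iff₀ (by linarith)]; linarith
  have hbase : StrictMono ![(0 : ℝ), 1, s, 2] := by
    refine Fin.strictMono_iff_lt_succ.2 fun i ↦ ?_
    fin_cases i
    · show (0 : ℝ) < 1; norm_num
    · exact hs1
    · exact hs2
  have hcr : crossRatio ![(0 : ℝ), 1, s, 2] = (u₂ - u₃) / u₂ := by
    have hu₂ : u₂ ≠ 0 := by rcases hsign with ⟨h, h'⟩ | ⟨h, h'⟩ <;> intro hh <;> linarith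
    rw [crossRatio_zero_one_two' (by linarith), hs, div_eq_div_iff ?_ hu₂]
    · field_simp; ring
    · exact div_ne_zero (mul_ne_zero two_ne_zero hu₂) hden
  -- the value of the Möbius map at `±s` is `u₂`
  have hMs : ∀ ε : ℝ, ε * ε = 1 → (u₃ / 2 * (ε * s) + 0) / (1 * (ε * s) + -ε) = u₂ := by
    intro ε hε
    have hden' : 1 * (ε * s) + -ε ≠ 0 := by
      have : 1 * (ε * s) + -ε = ε * (s - 1) := by ring
      rw [this]; exact mul_ne_zero (fun h ↦ by simp [h] at hε) (by linarith)
    rw [div_eq_iff hden', hs]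
    field_simp
    ring
  rcases hsign with ⟨h23, h3⟩ | ⟨h3, h32⟩
  · -- `u₂ < u₃ < 0`: pole at `1`
    have hdet : 0 < u₃ / 2 * (-1) - 0 * 1 := by linarith
    refine ⟨(ConformalEquiv.realMobius (u₃ / 2) 0 1 (-1) hdet).trans ψ, ![0, 1, s, 2],
      ConformalRectangle.isUniformizing_of_hasBoundaryValue (Or.inl hbase) ?_ ?_ ?_ ?_, hcr⟩
    · refine ConformalEquiv.hasBoundaryValue_realMobius_trans hdet ψ (x := 0) (by norm_num) ?_
      rw [show (u₃ / 2 * 0 + 0) / (1 * 0 + -1) = (0 : ℝ) by ring]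
      exact_mod_cast h₀
    · exact ConformalEquiv.hasBoundaryValue_realMobius_trans_pole hdet ψ (x := 1) (by norm_num) h₁
    · refine ConformalEquiv.hasBoundaryValue_realMobius_trans hdet ψ (x := s)
        (by intro hh; linarith) ?_
      rw [show (u₃ / 2 * s + 0) / (1 * s + -1) = (u₃ / 2 * (1 * s) + 0) / (1 * (1 * s) + -1) by
        ring, hMs 1 (by norm_num)]
      exact h₂
    · refine ConformalEquiv.hasBoundaryValue_realMobius_trans hdet ψ (x := 2) (by norm_num) ?_
      rw [show (u₃ / 2 * 2 + 0) / (1 * 2 + -1) = u₃ by ring]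
      exact h₃
  · -- `0 < u₃ < u₂`: pole at `-1`, antitone tuple
    have hdet : 0 < u₃ / 2 * 1 - 0 * 1 := by linarith
    refine ⟨(ConformalEquiv.realMobius (u₃ / 2) 0 1 1 hdet).trans ψ, fun i ↦ -(![0, 1, s, 2] i),
      ConformalRectangle.isUniformizing_of_hasBoundaryValue (Or.inr hbase.neg) ?_ ?_ ?_ ?_, ?_⟩
    · refine ConformalEquiv.hasBoundaryValue_realMobius_trans hdet ψ (x := -0) (by norm_num) ?_
      rw [show (u₃ / 2 * -0 + 0) / (1 * -0 + 1) = (0 : ℝ) by ring]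
      exact_mod_cast h₀
    · exact ConformalEquiv.hasBoundaryValue_realMobius_trans_pole hdet ψ (x := -1) (by norm_num) h₁
    · refine ConformalEquiv.hasBoundaryValue_realMobius_trans hdet ψ (x := -s)
        (by intro hh; linarith) ?_
      rw [show (u₃ / 2 * -s + 0) / (1 * -s + 1) = (u₃ / 2 * (-1 * s) + 0) / (1 * (-1 * s) + - -1) by
        ring, hMs (-1) (by norm_num)]
      exact h₂
    · refine ConformalEquiv.hasBoundaryValue_realMobius_trans hdet ψ (x := -2) (by norm_num) ?_
      rw [show (u₃ / 2 * -2 + 0) / (1 * -2 + 1) = u₃ by ring]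
      exact h₃
    · rw [show (fun i ↦ -(![(0 : ℝ), 1, s, 2] i)) = -![(0 : ℝ), 1, s, 2] from rfl, crossRatio_neg, hcr]

/-- **Reading (L): a uniformizing datum from the chordal map of `(Ω; p₀, p₃)`.** If `ψ : ℍₒ → Ω`
has boundary values `p₀` at `0`, `p₁` at `v₁`, `p₂` at `v₂` and `p₃` at `∞`, where
`0 < v₁ < v₂` or `v₂ < v₁ < 0`, then `R` has a uniformizing datum of cross-ratio `v₁/v₂`
(precompose `ψ` with `z ↦ ±v₂ z/(1 ∓ z)` and take `x = ±(0, v₁/(v₁+v₂), 1/2, 1)`). -/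
theorem exists_isUniformizing_crossRatio_eq_L {v₁ v₂ : ℝ} (h₀ : ψ.HasBoundaryValue 0 (R.pt 0))
    (h₁ : ψ.HasBoundaryValue v₁ (R.pt 1)) (h₂ : ψ.HasBoundaryValue v₂ (R.pt 2))
    (h₃ : ψ.HasBoundaryValueAtInfty (R.pt 3)) (hsign : 0 < v₁ ∧ v₁ < v₂ ∨ v₂ < v₁ ∧ v₁ < 0) :
    ∃ (φ₀ : ConformalEquiv upperHalfPlaneSet R.carrier) (x : Fin 4 → ℝ), R.IsUniformizing φ₀ x ∧
      crossRatio x = v₁ / v₂ := by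
  set s : ℝ := v₁ / (v₁ + v₂) with hs
  have hden : v₁ + v₂ ≠ 0 := by rcases hsign with ⟨h, h'⟩ | ⟨h, h'⟩ <;> intro hh <;> linarith
  have hs0 : 0 < s := by
    rcases hsign with ⟨h, h'⟩ | ⟨h, h'⟩
    · exact div_pos h (by linarith)
    · exact div_pos_of_neg_of_neg h' (by linarith)
  have hs2 : s < 1 / 2 := by
    rcases hsign with ⟨h, h'⟩ | ⟨h, h'⟩
    · rw [hs, div_lt_iff₀ (by linarith)]; linarith
    · rw [hs, div_lt_iff_of_neg (by linarith)]; linarith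
  have hbase : StrictMono ![(0 : ℝ), s, 1 / 2, 1] := by
    refine Fin.strictMono_iff_lt_succ.2 fun i ↦ ?_
    fin_cases i
    · exact hs0
    · exact hs2
    · show (1 / 2 : ℝ) < 1; norm_num
  have hcr : crossRatio ![(0 : ℝ), s, 1 / 2, 1] = v₁ / v₂ := by
    have hv₂ : v₂ ≠ 0 := by rcases hsign with ⟨h, h'⟩ | ⟨h, h'⟩ <;> intro hh <;> linarith
    rw [crossRatio_zero_half_one (by linarith), hs, div_eq_div_iff ?_ hv₂]
    · field_simp; ring
    · rw [show 1 - v₁ / (v₁ + v₂) = v₂ / (v₁ + v₂) by field_simp; ring]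
      exact div_ne_zero hv₂ hden
  -- the value of the Möbius map at `±s` is `v₁`
  have hMs : ∀ ε : ℝ, ε * ε = 1 → (ε * v₂ * (ε * s) + 0) / (-ε * (ε * s) + 1) = v₁ := by
    intro ε hε
    have hden' : -ε * (ε * s) + 1 ≠ 0 := by
      have : -ε * (ε * s) + 1 = 1 - s := by linear_combination (-s) * hε
      rw [this]; linarith
    rw [div_eq_iff hden', hs]
    field_simp
    linear_combination (v₂ * v₁ + v₁ * v₁) * hε
  rcases hsign with ⟨h1, h12⟩ | ⟨h21, h1⟩
  · -- `0 < v₁ < v₂`: pole at `1`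
    have hdet : 0 < v₂ * 1 - 0 * (-1) := by linarith
    refine ⟨(ConformalEquiv.realMobius v₂ 0 (-1) 1 hdet).trans ψ, ![0, s, 1 / 2, 1],
      ConformalRectangle.isUniformizing_of_hasBoundaryValue (Or.inl hbase) ?_ ?_ ?_ ?_, hcr⟩
    · refine ConformalEquiv.hasBoundaryValue_realMobius_trans hdet ψ (x := 0) (by norm_num) ?_
      rw [show (v₂ * 0 + 0) / (-1 * 0 + 1) = (0 : ℝ) by ring]
      exact_mod_cast h₀
    · refine ConformalEquiv.hasBoundaryValue_realMobius_trans hdet ψ (x := s)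
        (by intro hh; linarith) ?_
      rw [show (v₂ * s + 0) / (-1 * s + 1) = (1 * v₂ * (1 * s) + 0) / (-1 * (1 * s) + 1) by ring,
        hMs 1 (by norm_num)]
      exact h₁
    · refine ConformalEquiv.hasBoundaryValue_realMobius_trans hdet ψ (x := 1 / 2) (by norm_num) ?_
      rw [show (v₂ * (1 / 2) + 0) / (-1 * (1 / 2) + 1) = v₂ by ring]
      exact h₂
    · exact ConformalEquiv.hasBoundaryValue_realMobius_trans_pole hdet ψ (x := 1) (by norm_num) h₃
  · -- `v₂ < v₁ < 0`: pole at `-1`, antitone tuple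
    have hdet : 0 < -v₂ * 1 - 0 * 1 := by linarith
    refine ⟨(ConformalEquiv.realMobius (-v₂) 0 1 1 hdet).trans ψ, fun i ↦ -(![0, s, 1 / 2, 1] i),
      ConformalRectangle.isUniformizing_of_hasBoundaryValue (Or.inr hbase.neg) ?_ ?_ ?_ ?_, ?_⟩
    · refine ConformalEquiv.hasBoundaryValue_realMobius_trans hdet ψ (x := -0) (by norm_num) ?_
      rw [show (-v₂ * -0 + 0) / (1 * -0 + 1) = (0 : ℝ) by ring]
      exact_mod_cast h₀
    · refine ConformalEquiv.hasBoundaryValue_realMobius_trans hdet ψ (x := -s)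
        (by intro hh; linarith) ?_
      rw [show (-v₂ * -s + 0) / (1 * -s + 1) = (-1 * v₂ * (-1 * s) + 0) / (- -1 * (-1 * s) + 1) by
        ring, hMs (-1) (by norm_num)]
      exact h₁
    · refine ConformalEquiv.hasBoundaryValue_realMobius_trans hdet ψ (x := -(1 / 2)) (by norm_num) ?_
      rw [show (-v₂ * -(1 / 2) + 0) / (1 * -(1 / 2) + 1) = v₂ by ring]
      exact h₂
    · exact ConformalEquiv.hasBoundaryValue_realMobius_trans_pole hdet ψ (x := -1) (by norm_num) h₃
    · rw [show (fun i ↦ -(![(0 : ℝ), s, 1 / 2, 1] i)) = -![(0 : ℝ), s, 1 / 2, 1] from rfl,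
        crossRatio_neg, hcr]

end Datum

end Summit.CriticalPhenomena.CardyFormulaZ2.Cruxes.SLESixFamiliesGiveCardy.CollarTouchSandwich
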